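import Mathlib
import Summits.CriticalPhenomena.PercolationContinuityZ3.Theorems.PercNearOneGluingNoHeavyLowerTailThreeFamilyTripleMinus
import Summits.CriticalPhenomena.PercolationContinuityZ3.Theorems.PercNearOneGluingNoHeavyLowerTailThreeFamilyOrderedMiddle

/-!
# TRIPLE⁻ with an ORDERED outer family

Helper file for crux `stmt-CriticalPhenomena-4575` (`NoHeavyLowerTail`, route `PercNearOneGluingNoHeavy`),
new-inequality factory seat `prim-ineq-gen-3` (gen 12).  Everything here is PROVED.

**Theorem TRIPLE⁻-ord (`triple0_minus_ordered`).**  `P = P₁ ∪ P₂`, `Q`, `R` families in `S` with functions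
supported on them; `G` down-closed, containing the ORDERED differences `P₁ \\ (P₁ ∪ P₂)`, `P₂ \\ P₂` (not
`P₂ \\ P₁`), `R \\ R`, `P₁ ⊼ Q`, `Q ⊼ R`, `X \ (Y ∪ Z)` (`X ∈ P₁`), `Z \ (X ∪ Y)` (`X ∈ P`); no member of `P₁`
or `R` inside a member of `P₂`.  If the three moment functions agree on `G` then `κ_P = κ_R`.
Proof: if `κ_P` vanishes on `P₂` this is TRIPLE⁻-0 for `(P₁,Q,R)`.  Else take `x₀ ∈ P₂` of minimal size with
`κ_P(x₀) ≠ 0`; the TEST IDENTITY `Σ_{F ∈ G, F ⊆ S \ x₀} (-1)^{#F} μ(F) = κ_P(x₀)` (every support element `x` has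
`x \ x₀ ∈ G`, none lies inside `x₀`) against the full alternating sums (`= κ_P(x₀)` for `μ_P`, `= 0` for `μ_R`)
produces a set `F` disjoint from `x₀` with `μ_P(F) ≠ μ_R(F)`; a minimal such `E` has
`Σ_{U ∩ E = ∅} (κ_P - κ_R)(U) ≠ 0`, no `P`-member above it (`E ⊆ t \ x₀`), hence an `R`-member `z₁ ⊇ E`, no
`R`- or `Q`-member disjoint from it, and all `P`-, `Q`-traces in `G`; so the `P`- and `Q`-moments agree on `2^E`
and `Σ_{U ∩ E = ∅} κ_P = Σ κ_Q = 0 = Σ κ_R`, a contradiction.  Corollaries: `V_{P₁∪P₂} ⊓ V_Q ⊓ V_R = ⊥`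
(`V_inf_V_inf_V_eq_bot_of_blocks_ordered`) and the count with ordered outer and middle groups
(`card_add_card_add_card_le_of_blocks_ordered_outer`) — the 'ordered-outer TRIPLE⁻' of memo FINDINGS-gen11
(F11-7), which with the petal-enlargement certificates gives the oriented antipodal Hall theorem for the four
tournaments on four petals.  (prim-ineq-gen-3 gen 12, 2026-08-20.)
-/

namespace Summit.CriticalPhenomena.PercolationContinuityZ3.Theorems

namespace ThreeFamilyRank

open Finset Module
open scoped FinsetFamily

variable {α : Type*} [DecidableEq α]

/-- `Σ_{F ⊆ A} (-1)^{#F} = [A = ∅]` (rational version). -/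
theorem sum_powerset_neg_one_pow_card_rat (A : Finset α) :
    (∑ F ∈ A.powerset, (-1 : ℚ) ^ #F) = if A = ∅ then 1 else 0 := by
  have hz := (sum_powerset_neg_one_pow_card (x := A))
  have hcast : (∑ F ∈ A.powerset, (-1 : ℚ) ^ #F) = ((∑ F ∈ A.powerset, (-1 : ℤ) ^ #F : ℤ) : ℚ) := by
    push_cast; rfl
  rw [hcast, hz]
  split_ifs <;> simp

/-- **Alternating sums of moments detect disjointness.**  If `H` is a family of sets such that for every `U ⊆ S`
in the support of `κ` the members of `H` inside `U` are exactly the subsets of `U ∩ A`, then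
`Σ_{F ∈ H} (-1)^{#F} μ_κ(F) = Σ_{U ⊆ S, U ∩ A = ∅} κ(U)`. -/
theorem alt_sum_mom (S A : Finset α) (H : Finset (Finset α)) (κ : Finset α → ℚ)
    (hH : ∀ U ∈ S.powerset, κ U ≠ 0 → H.filter (· ⊆ U) = (U ∩ A).powerset) :
    (∑ F ∈ H, (-1 : ℚ) ^ #F * mom S κ F) = ∑ U ∈ S.powerset, (if U ∩ A = ∅ then κ U else 0) := by
  unfold mom
  have step1 : (∑ F ∈ H, (-1 : ℚ) ^ #F * ∑ U ∈ S.powerset, (if F ⊆ U then κ U else 0)) =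
      ∑ U ∈ S.powerset, ∑ F ∈ H, (-1 : ℚ) ^ #F * (if F ⊆ U then κ U else 0) := by
    rw [Finset.sum_comm]
    refine Finset.sum_congr rfl fun F _ => ?_
    rw [Finset.mul_sum]
  rw [step1]
  refine Finset.sum_congr rfl fun U hU => ?_
  have step2 : (∑ F ∈ H, (-1 : ℚ) ^ #F * (if F ⊆ U then κ U else 0)) =
      κ U * ∑ F ∈ H.filter (· ⊆ U), (-1 : ℚ) ^ #F := by
    rw [Finset.sum_filter, Finset.mul_sum]
    refine Finset.sum_congr rfl fun F _ => ?_
    split_ifs <;> ring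
  rw [step2]
  by_cases hκ : κ U = 0
  · simp [hκ]
  · rw [hH U hU hκ, sum_powerset_neg_one_pow_card_rat]
    split_ifs <;> simp

/-- The full alternating sum over `2^A`: `Σ_{F ⊆ A} (-1)^{#F} μ_κ(F) = Σ_{U ⊆ S, U ∩ A = ∅} κ(U)`. -/
theorem alt_sum_mom_powerset (S A : Finset α) (κ : Finset α → ℚ) :
    (∑ F ∈ A.powerset, (-1 : ℚ) ^ #F * mom S κ F) = ∑ U ∈ S.powerset, (if U ∩ A = ∅ then κ U else 0) := by
  refine alt_sum_mom S A A.powerset κ fun U _ _ => ?_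
  ext F
  simp only [Finset.mem_filter, Finset.mem_powerset, Finset.subset_inter_iff]
  tauto

/-- The `G`-part of the alternating sum, when the relevant traces lie in the down-closed family `G`:
`Σ_{F ∈ G, F ⊆ A} (-1)^{#F} μ_κ(F) = Σ_{U ⊆ S, U ∩ A = ∅} κ(U)` provided `U ∩ A ∈ G` for every `U` in the
support of `κ`. -/
theorem alt_sum_mom_filter (S A : Finset α) (G : Finset (Finset α)) (hG : ∀ E ∈ G, ∀ F, F ⊆ E → F ∈ G)
    (κ : Finset α → ℚ) (hκ : ∀ U ∈ S.powerset, κ U ≠ 0 → U ∩ A ∈ G) :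
    (∑ F ∈ G.filter (· ⊆ A), (-1 : ℚ) ^ #F * mom S κ F) =
      ∑ U ∈ S.powerset, (if U ∩ A = ∅ then κ U else 0) := by
  refine alt_sum_mom S A (G.filter (· ⊆ A)) κ fun U hU hne => ?_
  ext F
  simp only [Finset.mem_filter, Finset.mem_powerset, Finset.subset_inter_iff]
  constructor
  · rintro ⟨⟨_, hFA⟩, hFU⟩; exact ⟨hFU, hFA⟩
  · rintro ⟨hFU, hFA⟩
    exact ⟨⟨hG _ (hκ U hU hne) F (Finset.subset_inter hFU hFA), hFA⟩, hFU⟩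

/-- Splitting the full alternating sum into its `G`-part and the rest. -/
theorem alt_sum_split (A : Finset α) (G : Finset (Finset α)) (φ : Finset α → ℚ) :
    (∑ F ∈ A.powerset, (-1 : ℚ) ^ #F * φ F) =
      (∑ F ∈ G.filter (· ⊆ A), (-1 : ℚ) ^ #F * φ F) +
        ∑ F ∈ (A.powerset).filter (· ∉ G), (-1 : ℚ) ^ #F * φ F := by
  have h1 : G.filter (· ⊆ A) = (A.powerset).filter (· ∈ G) := by
    ext F
    simp only [Finset.mem_filter, Finset.mem_powerset]
    tauto
  rw [h1]
  exact (Finset.sum_filter_add_sum_filter_not _ _ _).symm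

/-- **TRIPLE⁻-ord.**  `P₁ ∪ P₂, Q, R` families of subsets of `S` with functions supported on them; `G` down-closed
in `S` containing `P₁ \\ (P₁ ∪ P₂)`, `P₂ \\ P₂`, `R \\ R`, `P₁ ⊼ Q`, `Q ⊼ R`, the double differences
`X \ (Y ∪ Z)` for `X ∈ P₁` and `Z \ (X ∪ Y)` for `X ∈ P₁ ∪ P₂`; no member of `P₁` or of `R` lies inside a member
of `P₂`.  If the three moment functions agree on `G` then `κ_P = κ_R`. -/
theorem triple0_minus_ordered (S : Finset α) (G P₁ P₂ Q R : Finset (Finset α)) (κP κQ κR : Finset α → ℚ)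
    (hGS : ∀ E ∈ G, E ⊆ S) (hG : ∀ E ∈ G, ∀ F, F ⊆ E → F ∈ G)
    (hP₁S : ∀ U ∈ P₁, U ⊆ S) (hP₂S : ∀ U ∈ P₂, U ⊆ S) (hQS : ∀ U ∈ Q, U ⊆ S) (hRS : ∀ U ∈ R, U ⊆ S)
    (sP : ∀ U, U ∉ P₁ ∪ P₂ → κP U = 0) (sQ : ∀ U, U ∉ Q → κQ U = 0) (sR : ∀ U, U ∉ R → κR U = 0)
    (hP₁P : ∀ Y ∈ P₁, ∀ X ∈ P₁ ∪ P₂, Y \ X ∈ G) (hP₂P₂ : ∀ X ∈ P₂, ∀ X' ∈ P₂, X \ X' ∈ G)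
    (hNC : ∀ Y ∈ P₁, ∀ X ∈ P₂, ¬ Y ⊆ X) (hNC₂ : ∀ Z ∈ R, ∀ X ∈ P₂, ¬ Z ⊆ X)
    (hRR : ∀ Z ∈ R, ∀ Z' ∈ R, Z \ Z' ∈ G)
    (hP₁Q : ∀ X ∈ P₁, ∀ Y ∈ Q, X ∩ Y ∈ G) (hQR : ∀ Y ∈ Q, ∀ Z ∈ R, Y ∩ Z ∈ G)
    (hDDP : ∀ X ∈ P₁, ∀ Y ∈ Q, ∀ Z ∈ R, X \ (Y ∪ Z) ∈ G)
    (hDDR : ∀ X ∈ P₁ ∪ P₂, ∀ Y ∈ Q, ∀ Z ∈ R, Z \ (X ∪ Y) ∈ G)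
    (hmom : ∀ E ∈ G, mom S κP E = mom S κQ E ∧ mom S κQ E = mom S κR E) :
    κP = κR := by
  classical
  by_cases hvan : ∀ X ∈ P₂, κP X = 0
  · -- `κ_P` lives on `P₁`: this is TRIPLE⁻-0 for `(P₁, Q, R)`
    have sP₁ : ∀ U, U ∉ P₁ → κP U = 0 := by
      intro U hU
      by_cases hU2 : U ∈ P₂
      · exact hvan U hU2
      · exact sP U (by rw [Finset.mem_union]; tauto)
    exact triple0_minus S G P₁ Q R κP κQ κR hGS hG hP₁S hQS hRS sP₁ sQ sR
      (fun X hX X' hX' => hP₁P X hX X' (Finset.mem_union_left _ hX')) hRR hP₁Q hQR hDDP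
      (fun X hX Y hY Z hZ => hDDR X (Finset.mem_union_left _ hX) Y hY Z hZ) hmom
  · exfalso
    push Not at hvan
    -- a member `x₀ ∈ P₂` of minimal cardinality with `κP x₀ ≠ 0`
    set P₂' : Finset (Finset α) := P₂.filter (fun X => κP X ≠ 0) with hP₂'
    have hne' : P₂'.Nonempty := by
      obtain ⟨X, hX, hκ⟩ := hvan; exact ⟨X, Finset.mem_filter.mpr ⟨hX, hκ⟩⟩
    obtain ⟨x₀, hx₀', hmin⟩ := Finset.exists_min_image P₂' (fun X => #X) hne'
    obtain ⟨hx₀P₂, hκx₀⟩ := Finset.mem_filter.mp hx₀'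
    have hx₀S : x₀ ⊆ S := hP₂S x₀ hx₀P₂
    -- every support element `x` of `κP` satisfies `x \ x₀ ∈ G`, and `x ⊆ x₀` forces `x = x₀`
    have hdiff : ∀ U, κP U ≠ 0 → U \ x₀ ∈ G := by
      intro U hU
      have hUP : U ∈ P₁ ∪ P₂ := by by_contra h; exact hU (sP U h)
      rcases Finset.mem_union.mp hUP with h1 | h2
      · exact hP₁P U h1 x₀ (Finset.mem_union_right _ hx₀P₂)
      · exact hP₂P₂ U h2 x₀ hx₀P₂
    have hbelow : ∀ U, κP U ≠ 0 → U ⊆ x₀ → U = x₀ := by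
      intro U hU hUx
      have hUP : U ∈ P₁ ∪ P₂ := by by_contra h; exact hU (sP U h)
      rcases Finset.mem_union.mp hUP with h1 | h2
      · exact absurd hUx (hNC U h1 x₀ hx₀P₂)
      · have hle := hmin U (Finset.mem_filter.mpr ⟨h2, hU⟩)
        exact Finset.eq_of_subset_of_card_le hUx hle
    -- the set `A = S \ x₀`
    set A : Finset α := S \ x₀ with hA
    have hAS : A ⊆ S := Finset.sdiff_subset
    have hUA : ∀ U ∈ S.powerset, U ∩ A = U \ x₀ := by
      intro U hU
      rw [hA]; ext a; simp only [Finset.mem_inter, Finset.mem_sdiff]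
      exact ⟨fun ⟨haU, _, hax⟩ => ⟨haU, hax⟩, fun ⟨haU, hax⟩ => ⟨haU, Finset.mem_powerset.mp hU haU, hax⟩⟩
    -- the disjointness sums
    have hdisjP : (∑ U ∈ S.powerset, (if U ∩ A = ∅ then κP U else 0)) = κP x₀ := by
      rw [Finset.sum_eq_single x₀]
      · have : x₀ ∩ A = ∅ := by rw [hUA x₀ (Finset.mem_powerset.mpr hx₀S), Finset.sdiff_self]
        simp [this]
      · intro U hU hUx
        by_cases hκ : κP U = 0
        · simp [hκ]
        · have hUsub : ¬ U ⊆ x₀ := fun h => hUx (hbelow U hκ h)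
          have : U ∩ A ≠ ∅ := by
            rw [hUA U hU]; exact fun h => hUsub (Finset.sdiff_eq_empty_iff_subset.mp h)
          simp [this]
      · intro h; exact absurd (Finset.mem_powerset.mpr hx₀S) h
    have hdisjR : (∑ U ∈ S.powerset, (if U ∩ A = ∅ then κR U else 0)) = 0 := by
      refine Finset.sum_eq_zero fun U hU => ?_
      by_cases hκ : κR U = 0
      · simp [hκ]
      · have hUR : U ∈ R := by by_contra h; exact hκ (sR U h)
        have : U ∩ A ≠ ∅ := by
          rw [hUA U hU]; exact fun h => hNC₂ U hUR x₀ hx₀P₂ (Finset.sdiff_eq_empty_iff_subset.mp h)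
        simp [this]
    -- the `G`-parts of the alternating sums agree (the moments agree on `G`)
    have hGpart : (∑ F ∈ G.filter (· ⊆ A), (-1 : ℚ) ^ #F * mom S κP F) =
        ∑ F ∈ G.filter (· ⊆ A), (-1 : ℚ) ^ #F * mom S κR F := by
      refine Finset.sum_congr rfl fun F hF => ?_
      have hFG : F ∈ G := (Finset.mem_filter.mp hF).1
      rw [(hmom F hFG).1, (hmom F hFG).2]
    -- the `G`-part for `κP` equals `κP x₀` (test identity)
    have hGP : (∑ F ∈ G.filter (· ⊆ A), (-1 : ℚ) ^ #F * mom S κP F) = κP x₀ := by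
      rw [alt_sum_mom_filter S A G hG κP (fun U hU hne => by rw [hUA U hU]; exact hdiff U hne), hdisjP]
    -- the full alternating sums
    have hfullP : (∑ F ∈ A.powerset, (-1 : ℚ) ^ #F * mom S κP F) = κP x₀ := by
      rw [alt_sum_mom_powerset, hdisjP]
    have hfullR : (∑ F ∈ A.powerset, (-1 : ℚ) ^ #F * mom S κR F) = 0 := by
      rw [alt_sum_mom_powerset, hdisjR]
    -- hence the non-`G` part of the alternating sum of `μ_P - μ_R` equals `κP x₀ ≠ 0`
    set d : Finset α → ℚ := fun U => κP U - κR U with hd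
    have hrest : (∑ F ∈ (A.powerset).filter (· ∉ G), (-1 : ℚ) ^ #F * (mom S κP F - mom S κR F)) = κP x₀ := by
      have eP := alt_sum_split A G (fun F => mom S κP F)
      have eR := alt_sum_split A G (fun F => mom S κR F)
      rw [show (∑ F ∈ (A.powerset).filter (· ∉ G), (-1 : ℚ) ^ #F * (mom S κP F - mom S κR F)) =
          (∑ F ∈ (A.powerset).filter (· ∉ G), (-1 : ℚ) ^ #F * mom S κP F) -
            ∑ F ∈ (A.powerset).filter (· ∉ G), (-1 : ℚ) ^ #F * mom S κR F by
        rw [← Finset.sum_sub_distrib]; exact Finset.sum_congr rfl fun F _ => by ring]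
      linarith [hfullP, hfullR, hGP, hGpart]
    -- a violator disjoint from `x₀`
    have hviol : ∃ F ∈ (A.powerset).filter (· ∉ G), mom S κP F - mom S κR F ≠ 0 := by
      by_contra hall
      push Not at hall
      have : (∑ F ∈ (A.powerset).filter (· ∉ G), (-1 : ℚ) ^ #F * (mom S κP F - mom S κR F)) = 0 :=
        Finset.sum_eq_zero fun F hF => by rw [hall F hF, mul_zero]
      rw [hrest] at this
      exact hκx₀ this
    obtain ⟨F₀, hF₀, hF₀ne⟩ := hviol
    have hF₀A : F₀ ⊆ A := Finset.mem_powerset.mp (Finset.mem_filter.mp hF₀).1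
    -- a violator `E ⊆ F₀` of minimal cardinality
    set VIOL : Finset (Finset α) := (F₀.powerset).filter (fun E => mom S κP E - mom S κR E ≠ 0) with hVIOL
    have hVne : VIOL.Nonempty := ⟨F₀, Finset.mem_filter.mpr ⟨Finset.mem_powerset.mpr le_rfl, hF₀ne⟩⟩
    obtain ⟨E, hEV, hEmin⟩ := Finset.exists_min_image VIOL (fun X => #X) hVne
    obtain ⟨hEF₀', hEne⟩ := Finset.mem_filter.mp hEV
    have hEF₀ : E ⊆ F₀ := Finset.mem_powerset.mp hEF₀'
    have hEA : E ⊆ A := hEF₀.trans hF₀A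
    have hES : E ⊆ S := hEA.trans hAS
    have hEx₀ : Disjoint E x₀ := by
      rw [hA] at hEA; exact Finset.disjoint_of_subset_left hEA Finset.sdiff_disjoint
    have hEG : E ∉ G := fun h => hEne (by rw [(hmom E h).1, (hmom E h).2, sub_self])
    have hproper : ∀ E', E' ⊆ E → E' ≠ E → mom S κP E' - mom S κR E' = 0 := by
      intro E' hE'E hE'ne
      by_contra hv
      have hE'V : E' ∈ VIOL := Finset.mem_filter.mpr ⟨Finset.mem_powerset.mpr (hE'E.trans hEF₀), hv⟩
      have hle := hEmin E' hE'V
      exact hE'ne (Finset.eq_of_subset_of_card_le hE'E hle)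
    -- Σ_{U ∩ E = ∅} (κP - κR)(U) = ± (μ_P - μ_R)(E) ≠ 0
    have hdE : (∑ U ∈ S.powerset, (if U ∩ E = ∅ then d U else 0)) ≠ 0 := by
      rw [← alt_sum_mom_powerset S E d]
      rw [Finset.sum_eq_single E]
      · have hm : mom S d E = mom S κP E - mom S κR E := mom_sub S κP κR E
        rw [hm]
        exact mul_ne_zero (pow_ne_zero _ (by norm_num)) hEne
      · intro E' hE' hE'ne
        have hm : mom S d E' = mom S κP E' - mom S κR E' := mom_sub S κP κR E'
        rw [hm, hproper E' (Finset.mem_powerset.mp hE') hE'ne, mul_zero]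
      · intro h; exact absurd (Finset.mem_powerset.mpr le_rfl) h
    -- no member of the support of `κP` contains `E`
    have hnoPtop : ∀ U, κP U ≠ 0 → ¬ E ⊆ U := by
      intro U hU hEU
      apply hEG
      refine hG _ (hdiff U hU) E ?_
      intro a ha
      exact Finset.mem_sdiff.mpr ⟨hEU ha, Finset.disjoint_left.mp hEx₀ ha⟩
    -- some `z₁ ∈ R` contains `E`
    have hz₁ : ∃ z₁ ∈ R, E ⊆ z₁ := by
      have hmomE : mom S d E ≠ 0 := by rw [mom_sub]; exact hEne
      unfold mom at hmomE
      obtain ⟨U, hU, hUne⟩ := Finset.exists_ne_zero_of_sum_ne_zero hmomE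
      have hEU : E ⊆ U := by by_contra h; simp [h] at hUne
      rw [if_pos hEU] at hUne
      have hκR : κR U ≠ 0 := fun h0 =>
        hnoPtop U (fun h1 => hUne (show κP U - κR U = 0 by rw [h0, h1, sub_zero])) hEU
      exact ⟨U, by by_contra h; exact hκR (sR U h), hEU⟩
    obtain ⟨z₁, hz₁R, hEz₁⟩ := hz₁
    -- no member of `R` is disjoint from `E`
    have hRmeet : ∀ Z ∈ R, Z ∩ E ≠ ∅ := by
      intro Z hZ h
      apply hEG
      refine hG _ (hRR z₁ hz₁R Z hZ) E fun a ha => Finset.mem_sdiff.mpr ⟨hEz₁ ha, fun haZ => ?_⟩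
      have : a ∈ Z ∩ E := Finset.mem_inter.mpr ⟨haZ, ha⟩
      rw [h] at this; exact absurd this (Finset.notMem_empty a)
    -- no member of `Q` is disjoint from `E`
    have hQmeet : ∀ Y ∈ Q, Y ∩ E ≠ ∅ := by
      intro Y hY h
      apply hEG
      refine hG _ (hDDR x₀ (Finset.mem_union_right _ hx₀P₂) Y hY z₁ hz₁R) E fun a ha =>
        Finset.mem_sdiff.mpr ⟨hEz₁ ha, fun hax => ?_⟩
      rcases Finset.mem_union.mp hax with h1 | h2
      · exact Finset.disjoint_left.mp hEx₀ ha h1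
      · have : a ∈ Y ∩ E := Finset.mem_inter.mpr ⟨h2, ha⟩
        rw [h] at this; exact absurd this (Finset.notMem_empty a)
    -- the `P`- and `Q`-moments agree on every subset of `E`
    have hPQloc : ∀ E', E' ⊆ E → mom S κP E' = mom S κQ E' := by
      intro E' hE'E
      by_cases hE'G : E' ∈ G
      · exact (hmom E' hE'G).1
      · rw [mom_eq_zero_of_superset S κP E', mom_eq_zero_of_superset S κQ E']
        · intro U _ hE'U
          by_contra hκ
          have hUQ : U ∈ Q := by by_contra h; exact hκ (sQ U h)
          apply hE'G
          refine hG _ (hQR U hUQ z₁ hz₁R) E' fun a ha => Finset.mem_inter.mpr ⟨hE'U ha, hEz₁ (hE'E ha)⟩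
        · intro U _ hE'U
          by_contra hκ
          apply hE'G
          refine hG _ (hdiff U hκ) E' fun a ha =>
            Finset.mem_sdiff.mpr ⟨hE'U ha, Finset.disjoint_left.mp hEx₀ (hE'E ha)⟩
    -- the three disjointness sums: P = Q (local equality), Q = 0, R = 0
    have hsumP : (∑ U ∈ S.powerset, (if U ∩ E = ∅ then κP U else 0)) =
        ∑ U ∈ S.powerset, (if U ∩ E = ∅ then κQ U else 0) := by
      rw [← alt_sum_mom_powerset S E κP, ← alt_sum_mom_powerset S E κQ]
      refine Finset.sum_congr rfl fun E' hE' => ?_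
      rw [hPQloc E' (Finset.mem_powerset.mp hE')]
    have hsumQ : (∑ U ∈ S.powerset, (if U ∩ E = ∅ then κQ U else 0)) = 0 :=
      Finset.sum_eq_zero fun U _ => by
        by_cases hκ : κQ U = 0
        · simp [hκ]
        · simp [hQmeet U (by by_contra h; exact hκ (sQ U h))]
    have hsumR : (∑ U ∈ S.powerset, (if U ∩ E = ∅ then κR U else 0)) = 0 :=
      Finset.sum_eq_zero fun U _ => by
        by_cases hκ : κR U = 0
        · simp [hκ]
        · simp [hRmeet U (by by_contra h; exact hκ (sR U h))]
    have hsumd : (∑ U ∈ S.powerset, (if U ∩ E = ∅ then d U else 0)) =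
        (∑ U ∈ S.powerset, (if U ∩ E = ∅ then κP U else 0)) -
          ∑ U ∈ S.powerset, (if U ∩ E = ∅ then κR U else 0) := by
      rw [← Finset.sum_sub_distrib]
      refine Finset.sum_congr rfl fun U _ => ?_
      split_ifs <;> simp [hd]
    apply hdE
    rw [hsumd, hsumP, hsumQ, hsumR, sub_zero]

/-- **TRIPLE⁻ with an ordered outer family.**  If moreover no set lies in both `P₁ ∪ P₂` and `R`, the spans of
the plain vectors in `ℚ^G` have trivial triple intersection. -/
theorem V_inf_V_inf_V_eq_bot_of_blocks_ordered (S : Finset α) (G P₁ P₂ Q R : Finset (Finset α))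
    (hGS : ∀ E ∈ G, E ⊆ S) (hG : ∀ E ∈ G, ∀ F, F ⊆ E → F ∈ G)
    (hP₁S : ∀ U ∈ P₁, U ⊆ S) (hP₂S : ∀ U ∈ P₂, U ⊆ S) (hQS : ∀ U ∈ Q, U ⊆ S) (hRS : ∀ U ∈ R, U ⊆ S)
    (hP₁P : ∀ Y ∈ P₁, ∀ X ∈ P₁ ∪ P₂, Y \ X ∈ G) (hP₂P₂ : ∀ X ∈ P₂, ∀ X' ∈ P₂, X \ X' ∈ G)
    (hNC : ∀ Y ∈ P₁, ∀ X ∈ P₂, ¬ Y ⊆ X) (hNC₂ : ∀ Z ∈ R, ∀ X ∈ P₂, ¬ Z ⊆ X)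
    (hRR : ∀ Z ∈ R, ∀ Z' ∈ R, Z \ Z' ∈ G)
    (hP₁Q : ∀ X ∈ P₁, ∀ Y ∈ Q, X ∩ Y ∈ G) (hQR : ∀ Y ∈ Q, ∀ Z ∈ R, Y ∩ Z ∈ G)
    (hDDP : ∀ X ∈ P₁, ∀ Y ∈ Q, ∀ Z ∈ R, X \ (Y ∪ Z) ∈ G)
    (hDDR : ∀ X ∈ P₁ ∪ P₂, ∀ Y ∈ Q, ∀ Z ∈ R, Z \ (X ∪ Y) ∈ G)
    (hdisj : ∀ U ∈ P₁ ∪ P₂, U ∉ R) :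
    V G (P₁ ∪ P₂) ⊓ V G Q ⊓ V G R = ⊥ := by
  rw [Submodule.eq_bot_iff]
  intro v hv
  rw [Submodule.mem_inf, Submodule.mem_inf] at hv
  obtain ⟨⟨hvP, hvQ⟩, hvR⟩ := hv
  have hPS : ∀ U ∈ P₁ ∪ P₂, U ⊆ S := fun U hU => by
    rcases Finset.mem_union.mp hU with h | h
    exacts [hP₁S U h, hP₂S U h]
  obtain ⟨κP, sP, hP⟩ := exists_kappa_of_mem_V S G (P₁ ∪ P₂) hPS hvP
  obtain ⟨κQ, sQ, hQ⟩ := exists_kappa_of_mem_V S G Q hQS hvQ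
  obtain ⟨κR, sR, hR⟩ := exists_kappa_of_mem_V S G R hRS hvR
  have hmom : ∀ E ∈ G, mom S κP E = mom S κQ E ∧ mom S κQ E = mom S κR E := by
    intro E hE
    have e1 := hP ⟨E, hE⟩; have e2 := hQ ⟨E, hE⟩; have e3 := hR ⟨E, hE⟩
    exact ⟨e1.symm.trans e2, e2.symm.trans e3⟩
  have hPR := triple0_minus_ordered S G P₁ P₂ Q R κP κQ κR hGS hG hP₁S hP₂S hQS hRS sP sQ sR hP₁P hP₂P₂
    hNC hNC₂ hRR hP₁Q hQR hDDP hDDR hmom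
  have hzero : ∀ U, κP U = 0 := by
    intro U
    by_cases h1 : U ∈ P₁ ∪ P₂
    · rw [hPR]; exact sR U (hdisj U h1)
    · exact sP U h1
  funext E
  rw [hP E, mom]
  simp [hzero]

/-- **Three-family count with an ordered OUTER group and an ordered middle group.**  `P₁ ∪ P₂`, `Q₁ ∪ Q₂`, `R`
pairwise cross-intersecting families of subsets of `S`, no set in both `P₁ ∪ P₂` and `R`; `G` down-closed in `S`
containing the ordered differences `P₁ \\ P₁`, `P₂ \\ P₂`, `P₁ \\ P₂`, `Q₁ \\ Q₁`, `Q₂ \\ Q₂`, `Q₁ \\ Q₂`,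
`R \\ R`, all cross meets, the double differences `X \ (Y ∪ Z)` (`X ∈ P₁`) and `Z \ (X ∪ Y)` (all `X`); no
member of `P₁` or `R` inside a member of `P₂`, no member of `Q₁` inside a member of `Q₂`.  Then
`#(P₁ ∪ P₂) + #(Q₁ ∪ Q₂) + #R ≤ #G`. -/
theorem card_add_card_add_card_le_of_blocks_ordered_outer (S : Finset α)
    (G P₁ P₂ Q₁ Q₂ R : Finset (Finset α))
    (hGS : ∀ E ∈ G, E ⊆ S) (hG : ∀ E ∈ G, ∀ F, F ⊆ E → F ∈ G)
    (hP₁S : ∀ U ∈ P₁, U ⊆ S) (hP₂S : ∀ U ∈ P₂, U ⊆ S) (hQS : ∀ U ∈ Q₁ ∪ Q₂, U ⊆ S)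
    (hRS : ∀ U ∈ R, U ⊆ S)
    (hP₁₁ : ∀ X ∈ P₁, ∀ X' ∈ P₁, X \ X' ∈ G) (hP₂₂ : ∀ X ∈ P₂, ∀ X' ∈ P₂, X \ X' ∈ G)
    (hP₁₂ : ∀ X ∈ P₁, ∀ X' ∈ P₂, X \ X' ∈ G ∧ ¬ X ⊆ X')
    (hQ₁₁ : ∀ Y ∈ Q₁, ∀ Y' ∈ Q₁, Y \ Y' ∈ G) (hQ₂₂ : ∀ Y ∈ Q₂, ∀ Y' ∈ Q₂, Y \ Y' ∈ G)
    (hQ₁₂ : ∀ Y ∈ Q₁, ∀ Y' ∈ Q₂, Y \ Y' ∈ G ∧ ¬ Y ⊆ Y')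
    (hRR : ∀ Z ∈ R, ∀ Z' ∈ R, Z \ Z' ∈ G)
    (hRP₂ : ∀ Z ∈ R, ∀ X ∈ P₂, ¬ Z ⊆ X)
    (hPQ : ∀ X ∈ P₁ ∪ P₂, ∀ Y ∈ Q₁ ∪ Q₂, X ∩ Y ∈ G ∧ (X ∩ Y).Nonempty)
    (hQR : ∀ Y ∈ Q₁ ∪ Q₂, ∀ Z ∈ R, Y ∩ Z ∈ G ∧ (Y ∩ Z).Nonempty)
    (hRP : ∀ Z ∈ R, ∀ X ∈ P₁ ∪ P₂, Z ∩ X ∈ G ∧ (Z ∩ X).Nonempty)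
    (hDDP : ∀ X ∈ P₁, ∀ Y ∈ Q₁ ∪ Q₂, ∀ Z ∈ R, X \ (Y ∪ Z) ∈ G)
    (hDDR : ∀ X ∈ P₁ ∪ P₂, ∀ Y ∈ Q₁ ∪ Q₂, ∀ Z ∈ R, Z \ (X ∪ Y) ∈ G)
    (hdisj : ∀ U ∈ P₁ ∪ P₂, U ∉ R) :
    #(P₁ ∪ P₂) + #(Q₁ ∪ Q₂) + #R ≤ #G := by
  have hP := finrank_V_union G hG P₁ P₂ hP₁₁ hP₂₂ hP₁₂
  have hQ := finrank_V_union G hG Q₁ Q₂ hQ₁₁ hQ₂₂ hQ₁₂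
  have hR := finrank_V G hG R hRR
  have hP₁P : ∀ Y ∈ P₁, ∀ X ∈ P₁ ∪ P₂, Y \ X ∈ G := fun Y hY X hX => by
    rcases Finset.mem_union.mp hX with h | h
    exacts [hP₁₁ Y hY X h, (hP₁₂ Y hY X h).1]
  have htriple := V_inf_V_inf_V_eq_bot_of_blocks_ordered S G P₁ P₂ (Q₁ ∪ Q₂) R hGS hG hP₁S hP₂S hQS hRS
    hP₁P hP₂₂ (fun Y hY X hX => (hP₁₂ Y hY X hX).2) hRP₂ hRR
    (fun X hX Y hY => (hPQ X (Finset.mem_union_left _ hX) Y hY).1) (fun Y hY Z hZ => (hQR Y hY Z hZ).1)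
    hDDP hDDR hdisj
  have h := card_add_card_add_card_le_of_finrank G hG (P₁ ∪ P₂) (Q₁ ∪ Q₂) R hP hQ hR hPQ hQR hRP
  rw [htriple, finrank_bot] at h; simpa using h

end ThreeFamilyRank

end Summit.CriticalPhenomena.PercolationContinuityZ3.Theorems
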